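import Mathlib.Analysis.InnerProductSpace.PiL2
import Mathlib.Analysis.SpecialFunctions.Complex.Arg
import Mathlib.Analysis.SpecialFunctions.Trigonometric.Bounds
import Mathlib.Analysis.SpecialFunctions.Trigonometric.Inverse
import Mathlib.Analysis.Real.Pi.Bounds
import Mathlib.Data.Set.Card
import Literature.Geometry.DiscreteGeometry.SphericalCapVolume
import Summits.AtomisticToContinuum.Crystallization.Theorems.HullExactificationCascadeZeroDefectDensitySoftDegreeLeFour
import HarnessLib

/-!
# Tangent-plane windows at a shell vertex — part 1/2: planar, conical and counting lemmas
# (route `HullExactificationCascade`, crux `ZeroDefectDensity`, stmt-AtomisticToContinuum-12086;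
# line `birth`, stub `stub_censusFrame`, auxiliary file)

Configuration-free lemmas for the registered stub `stub_censusFrame` (part 2):

* Part A/B — the constant `2π < 3 arccos (-0.136) + arccos 0.344` and the pigeonhole on four
  cyclic gaps: four nonnegative angles summing to `2π`, each with cosine `≤ 0.344`, contain two
  with cosine `> -0.136` (`cf_four_gaps`); sorted form `cf_four_sorted_angles`.
* Part C — four unit vectors of the plane with pairwise inner products `≤ 0.344` contain two
  distinct pairs with inner product `> -0.136` (`cf_four_directions`, sorting the arguments as in
  worker K1's `sdeg_five_directions_false`); three such vectors contain a pair with inner product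
  `< 0.323` (`cf_three_directions`, Gram determinant).
* Part D — two unit vectors `a, b` with `⟪a, b⟫ ≤ 2c² - 1` have disjoint cap cones
  `capCone · c` (`cf_capCone_inter_eq_empty`); two shell points `1 ± 1/4000` from the centre and
  `≥ 7/5` apart have direction cosine `≤ 2 (893/1250)² - 1` (`cf_far_inner`), hence disjoint cap
  cones (`cf_far_capCone`) and disjoint "beyond" regions in any cap (`cf_far_beyond`).
* Part E — two distinct unordered pairs give `ncard ≥ 2` for a set of increasing pairs.
* Part F — the registered auxiliary stub `stub_censusFrameAux` (= `cf_far_capCone`, ∀-form).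

Mathlib + K1's `sdeg_arccos_le_of_cos_le`, `sdeg_inner_eq_cos_sub`; no named fact is used.
-/

noncomputable section

namespace Summit.AtomisticToContinuum.Crystallization.Theorems.ZeroDefectDensityBirth

open Real
open scoped InnerProductSpace
open Literature.Geometry.DiscreteGeometry (capCone)

/-! ## Part A. One trigonometric constant -/

/-- `2π < 3 · arccos (-0.136) + arccos 0.344`: with `arccos (-c) = π - arccos c` and
`arccos c = π/2 - arcsin c` this is `arcsin 0.344 < 3 · arcsin 0.136`, and indeed
`arcsin 0.344 < 0.408 ≤ 3 · arcsin 0.136` (`sin 0.408 > 0.344`, `sin 0.136 < 0.136`).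
[folklore] -/
theorem cf_two_pi_lt_gaps : 2 * π < 3 * arccos (-0.136 : ℝ) + arccos 0.344 := by
  have h1 : (0.136 : ℝ) ≤ arcsin 0.136 := by
    rw [le_arcsin_iff_sin_le' ⟨by linarith [pi_gt_three], by linarith [pi_gt_three]⟩]
    exact (sin_lt (by norm_num)).le
  have h2 : arcsin (0.344 : ℝ) < 0.408 := by
    rw [arcsin_lt_iff_lt_sin' ⟨by linarith [pi_gt_three], by linarith [pi_gt_three]⟩]
    have := sin_gt_sub_cube (x := (0.408 : ℝ)) (by norm_num)
    linarith
  rw [arccos_neg, arccos_eq_pi_div_two_sub_arcsin, arccos_eq_pi_div_two_sub_arcsin]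
  linarith

/-! ## Part B. Four gaps around a circle -/

/-- **Two small gaps among four.** Four nonnegative angles summing to `2π`, each with cosine
`≤ 0.344` (so each `≥ arccos 0.344`), cannot contain three with cosine `≤ -0.136` (each of those
is `≥ arccos (-0.136)`, and `3 arccos (-0.136) + arccos 0.344 > 2π`); hence two distinct gaps
have cosine `> -0.136`. [folklore] -/
theorem cf_four_gaps (g : Fin 4 → ℝ) (h0 : ∀ k, 0 ≤ g k)
    (hsum : g 0 + g 1 + g 2 + g 3 = 2 * π) (hc : ∀ k, cos (g k) ≤ 0.344) :
    ∃ a b, a ≠ b ∧ -0.136 < cos (g a) ∧ -0.136 < cos (g b) := by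
  have hlow : ∀ k, arccos 0.344 ≤ g k := fun k => sdeg_arccos_le_of_cos_le (h0 k) (hc k)
  have hfar : ∀ k, cos (g k) ≤ -0.136 → arccos (-0.136) ≤ g k := fun k hk =>
    sdeg_arccos_le_of_cos_le (h0 k) hk
  have hkey := cf_two_pi_lt_gaps
  have l0 := hlow 0; have l1 := hlow 1; have l2 := hlow 2; have l3 := hlow 3
  by_contra H
  push Not at H
  rcases em (∃ a, -0.136 < cos (g a)) with ⟨a, ha⟩ | hall
  · have hb : ∀ b, b ≠ a → arccos (-0.136) ≤ g b := fun b hb =>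
      hfar b (H a b (Ne.symm hb) ha)
    fin_cases a
    · have f1 := hb 1 (by decide); have f2 := hb 2 (by decide); have f3 := hb 3 (by decide)
      linarith
    · have f0 := hb 0 (by decide); have f2 := hb 2 (by decide); have f3 := hb 3 (by decide)
      linarith
    · have f0 := hb 0 (by decide); have f1 := hb 1 (by decide); have f3 := hb 3 (by decide)
      linarith
    · have f0 := hb 0 (by decide); have f1 := hb 1 (by decide); have f2 := hb 2 (by decide)
      linarith
  · push Not at hall
    have f0 := hfar 0 (hall 0); have f1 := hfar 1 (hall 1); have f2 := hfar 2 (hall 2)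
    linarith

/-- **Four sorted directions.** Four angles `-π < t₀ < t₁ < t₂ < t₃ ≤ π` all of whose pairwise
differences have cosine `≤ 0.344` have two distinct cyclically consecutive pairs `(a, a+1)`,
`(b, b+1)` (indices mod 4) whose differences have cosine `> -0.136` (apply `cf_four_gaps` to the
three consecutive gaps and the wrap-around gap `2π - (t₃ - t₀)`). [folklore] -/
theorem cf_four_sorted_angles (t : Fin 4 → ℝ) (hmono : StrictMono t) (hlo : -π < t 0)
    (hhi : t 3 ≤ π) (hC : ∀ i j, i ≠ j → cos (t i - t j) ≤ 0.344) :
    ∃ a b : Fin 4, a ≠ b ∧ -0.136 < cos (t a - t (a + 1)) ∧ -0.136 < cos (t b - t (b + 1)) := by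
  have h01 : t 0 < t 1 := hmono (by decide)
  have h12 : t 1 < t 2 := hmono (by decide)
  have h23 : t 2 < t 3 := hmono (by decide)
  set g : Fin 4 → ℝ := ![t 1 - t 0, t 2 - t 1, t 3 - t 2, 2 * π - (t 3 - t 0)] with hg
  have hcos : ∀ a, cos (g a) = cos (t a - t (a + 1)) := by
    intro a
    fin_cases a
    · simp [hg, ← cos_neg (t 0 - t 1)]
    · simp [hg, ← cos_neg (t 1 - t 2)]
    · simp [hg, ← cos_neg (t 2 - t 3)]
    · simp [hg, cos_two_pi_sub]
  have hg0 : ∀ k, 0 ≤ g k := by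
    intro k
    fin_cases k <;> simp [hg] <;> linarith
  have e0 : g 0 = t 1 - t 0 := rfl
  have e1 : g 1 = t 2 - t 1 := rfl
  have e2 : g 2 = t 3 - t 2 := rfl
  have e3 : g 3 = 2 * π - (t 3 - t 0) := rfl
  have hgs : g 0 + g 1 + g 2 + g 3 = 2 * π := by
    rw [e0, e1, e2, e3]
    ring
  have hgc : ∀ k, cos (g k) ≤ 0.344 := by
    intro k
    rw [hcos]
    have hk : k ≠ k + 1 := by revert k; decide
    exact hC k (k + 1) hk
  obtain ⟨a, b, hab, ha, hb⟩ := cf_four_gaps g hg0 hgs hgc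
  exact ⟨a, b, hab, (hcos a) ▸ ha, (hcos b) ▸ hb⟩

/-! ## Part C. Directions of the plane -/

/-- **Four soft directions of the plane.** Four unit vectors `e_k = (x_k, y_k)` of the plane with
`⟪e_k, e_l⟫ ≤ 0.344` for `k ≠ l` contain two distinct (unordered) pairs `{k, l} ≠ {k', l'}` with
`⟪e_k, e_l⟫ > -0.136` and `⟪e_k', e_l'⟫ > -0.136`: sort the arguments `θ_k = arg (x_k + i y_k)`
(pairwise distinct as `cos 0 = 1`) and apply `cf_four_sorted_angles`. [folklore] -/
theorem cf_four_directions (x y : Fin 4 → ℝ) (hxy : ∀ k, x k ^ 2 + y k ^ 2 = 1)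
    (hC : ∀ k l, k ≠ l → x k * x l + y k * y l ≤ 0.344) :
    ∃ k l k' l' : Fin 4, k ≠ l ∧ k' ≠ l' ∧ ¬(k = k' ∧ l = l') ∧ ¬(k = l' ∧ l = k') ∧
      -0.136 < x k * x l + y k * y l ∧ -0.136 < x k' * x l' + y k' * y l' := by
  set θ : Fin 4 → ℝ := fun k => Complex.arg ⟨x k, y k⟩ with hθdef
  have hcos : ∀ k l, x k * x l + y k * y l = cos (θ k - θ l) := fun k l =>
    sdeg_inner_eq_cos_sub (hxy k) (hxy l)
  have hθinj : Function.Injective θ := by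
    intro k l hkl
    by_contra hne
    have h := hC k l hne
    rw [hcos, hkl, sub_self, cos_zero] at h
    norm_num at h
  have hC' : ∀ k l, k ≠ l → cos (θ k - θ l) ≤ 0.344 := fun k l hkl => by
    rw [← hcos]
    exact hC k l hkl
  -- sort the four angles
  have hAcard : (Finset.univ.image θ).card = 4 := by
    rw [Finset.card_image_of_injective _ hθinj, Finset.card_univ, Fintype.card_fin]
  let e := (Finset.univ.image θ).orderEmbOfFin hAcard
  have hmem : ∀ k, ∃ i, θ i = e k := by
    intro k
    have := (Finset.univ.image θ).orderEmbOfFin_mem hAcard k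
    rw [Finset.mem_image] at this
    obtain ⟨i, -, hi⟩ := this
    exact ⟨i, hi⟩
  choose π' hπ' using hmem
  have hπinj : ∀ a b, π' a = π' b → a = b := fun a b h =>
    e.injective (by rw [← hπ' a, ← hπ' b, h])
  obtain ⟨a, b, hab, ha, hb⟩ := cf_four_sorted_angles (fun k => e k) e.strictMono
    (by show -π < e 0; rw [← hπ' 0]; exact Complex.neg_pi_lt_arg _)
    (by show e 3 ≤ π; rw [← hπ' 3]; exact Complex.arg_le_pi _)
    (fun i j hij => by
      have hne : π' i ≠ π' j := fun h => hij (hπinj _ _ h)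
      rw [← hπ' i, ← hπ' j]
      exact hC' _ _ hne)
  have hsucc : ∀ c : Fin 4, c ≠ c + 1 := by decide
  have hswap : ∀ c d : Fin 4, c = d + 1 → c + 1 = d → False := by decide
  refine ⟨π' a, π' (a + 1), π' b, π' (b + 1), fun h => hsucc a (hπinj _ _ h),
    fun h => hsucc b (hπinj _ _ h), fun h => hab (hπinj _ _ h.1),
    fun h => hswap a b (hπinj _ _ h.1) (hπinj _ _ h.2), ?_, ?_⟩
  · rw [hcos, hπ', hπ']
    exact ha
  · rw [hcos, hπ', hπ']
    exact hb

/-- **Three soft directions of the plane.** Three unit vectors of the plane with pairwise inner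
products `≤ 0.344` have a pair with inner product `< 0.323`: otherwise all three Gram entries lie
in `[0.323, 0.344]` and the (vanishing) Gram determinant `1 + 2·d₁₂d₁₃d₂₃ - d₁₂² - d₁₃² - d₂₃²`
would be positive. [folklore] -/
theorem cf_three_directions {x₁ y₁ x₂ y₂ x₃ y₃ : ℝ} (h₁ : x₁ ^ 2 + y₁ ^ 2 = 1)
    (h₂ : x₂ ^ 2 + y₂ ^ 2 = 1) (h₃ : x₃ ^ 2 + y₃ ^ 2 = 1)
    (c₁₂ : x₁ * x₂ + y₁ * y₂ ≤ 0.344) (c₁₃ : x₁ * x₃ + y₁ * y₃ ≤ 0.344)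
    (c₂₃ : x₂ * x₃ + y₂ * y₃ ≤ 0.344) :
    x₁ * x₂ + y₁ * y₂ < 0.323 ∨ x₁ * x₃ + y₁ * y₃ < 0.323 ∨ x₂ * x₃ + y₂ * y₃ < 0.323 := by
  by_contra H
  push Not at H
  obtain ⟨d₁₂, d₁₃, d₂₃⟩ := H
  have hG : (x₁ ^ 2 + y₁ ^ 2) * (x₂ ^ 2 + y₂ ^ 2) * (x₃ ^ 2 + y₃ ^ 2) +
      2 * (x₁ * x₂ + y₁ * y₂) * (x₁ * x₃ + y₁ * y₃) * (x₂ * x₃ + y₂ * y₃) -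
      (x₁ ^ 2 + y₁ ^ 2) * (x₂ * x₃ + y₂ * y₃) ^ 2 -
      (x₂ ^ 2 + y₂ ^ 2) * (x₁ * x₃ + y₁ * y₃) ^ 2 -
      (x₃ ^ 2 + y₃ ^ 2) * (x₁ * x₂ + y₁ * y₂) ^ 2 = 0 := by
    ring
  rw [h₁, h₂, h₃] at hG
  nlinarith [mul_nonneg (mul_nonneg (by linarith : (0 : ℝ) ≤ x₁ * x₂ + y₁ * y₂)
    (by linarith : (0 : ℝ) ≤ x₁ * x₃ + y₁ * y₃)) (by linarith : (0 : ℝ) ≤ x₂ * x₃ + y₂ * y₃),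
    mul_le_mul c₁₂ c₁₂ (by linarith) (by norm_num : (0 : ℝ) ≤ 0.344),
    mul_le_mul c₁₃ c₁₃ (by linarith) (by norm_num : (0 : ℝ) ≤ 0.344),
    mul_le_mul c₂₃ c₂₃ (by linarith) (by norm_num : (0 : ℝ) ≤ 0.344)]

/-! ## Part D. Cap cones of far directions -/

/-- **Disjoint cap cones.** Two unit vectors `a, b` with `⟪a, b⟫ ≤ 2c² - 1` (`c ≥ 0`; angle
`≥ 2 arccos c`) have disjoint open cones of parameter `c`: a common point `x ≠ 0` would give
`2c‖x‖ < ⟪a + b, x⟫ ≤ ‖a + b‖ ‖x‖`, so `4c² < ‖a + b‖² = 2 + 2⟪a, b⟫`. [folklore] -/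
theorem cf_capCone_inter_eq_empty {a b : EuclideanSpace ℝ (Fin 3)} (ha : ‖a‖ = 1)
    (hb : ‖b‖ = 1) {c : ℝ} (hc : 0 ≤ c) (hab : ⟪a, b⟫_ℝ ≤ 2 * c ^ 2 - 1) :
    capCone a c ∩ capCone b c = ∅ := by
  rw [Set.eq_empty_iff_forall_notMem]
  rintro x ⟨⟨hxa, -⟩, ⟨hxb, -⟩⟩
  simp only [Set.mem_setOf_eq] at hxa hxb
  have h1 : ⟪a + b, x⟫_ℝ ≤ ‖a + b‖ * ‖x‖ := real_inner_le_norm _ _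
  rw [inner_add_left] at h1
  have h2 : ‖a + b‖ ^ 2 = 2 + 2 * ⟪a, b⟫_ℝ := by
    rw [norm_add_sq_real, ha, hb]
    ring
  have hx : 0 < ‖x‖ := by
    rcases (norm_nonneg x).lt_or_eq with h | h
    · exact h
    · exfalso
      have hx0 : x = 0 := norm_eq_zero.mp h.symm
      rw [hx0, inner_zero_right, norm_zero, mul_zero] at hxa
      exact lt_irrefl _ hxa
  have h3 : 2 * c * ‖x‖ < ‖a + b‖ * ‖x‖ := by linarith
  have h4 : 2 * c < ‖a + b‖ := lt_of_mul_lt_mul_right h3 hx.le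
  nlinarith [mul_self_lt_mul_self (by linarith : 0 ≤ 2 * c) h4]

/-- **Far directions.** Two points `v, w` at distance `1 ± 1/4000` from `u` and `≥ 7/5` apart
have direction cosine `⟪dir v, dir w⟫ ≤ 2 (893/1250)² - 1` (`= 0.02073472`; the direction
cosine is at most `0.02052`). [folklore] -/
theorem cf_far_inner {u v w : EuclideanSpace ℝ (Fin 3)}
    (hv : 1 - 1 / 4000 ≤ dist u v ∧ dist u v ≤ 1 + 1 / 4000)
    (hw : 1 - 1 / 4000 ≤ dist u w ∧ dist u w ≤ 1 + 1 / 4000) (hvw : 7 / 5 ≤ dist v w) :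
    ⟪‖v - u‖⁻¹ • (v - u), ‖w - u‖⁻¹ • (w - u)⟫_ℝ ≤ 2 * (893 / 1250) ^ 2 - 1 := by
  obtain ⟨hv1, hv2⟩ := hv
  obtain ⟨hw1, hw2⟩ := hw
  rw [dist_comm, dist_eq_norm] at hv1 hv2 hw1 hw2
  rw [dist_eq_norm] at hvw
  set A := ‖v - u‖ with hA
  set B := ‖w - u‖ with hB
  have hA0 : 0 < A := by linarith
  have hB0 : 0 < B := by linarith
  have hD : ‖v - w‖ ^ 2 = A ^ 2 - 2 * ⟪v - u, w - u⟫_ℝ + B ^ 2 := by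
    rw [← norm_sub_sq_real, sub_sub_sub_cancel_right]
  have hg : ⟪v - u, w - u⟫_ℝ ≤ (2 * (893 / 1250) ^ 2 - 1) * (A * B) := by
    nlinarith [mul_le_mul hvw hvw (by norm_num) (norm_nonneg _),
      mul_le_mul hv1 hw1 (by norm_num) hA0.le, mul_le_mul hv2 hv2 (norm_nonneg _) (by norm_num),
      mul_le_mul hw2 hw2 (norm_nonneg _) (by norm_num)]
  rw [real_inner_smul_left, real_inner_smul_right]
  calc A⁻¹ * (B⁻¹ * ⟪v - u, w - u⟫_ℝ)
      ≤ A⁻¹ * (B⁻¹ * ((2 * (893 / 1250) ^ 2 - 1) * (A * B))) := by gcongr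
    _ = 2 * (893 / 1250) ^ 2 - 1 := by field_simp

/-- The direction `‖v - u‖⁻¹ • (v - u)` of a point of the shell is a unit vector. [folklore] -/
theorem cf_norm_dir {u v : EuclideanSpace ℝ (Fin 3)} (hv : 1 - 1 / 4000 ≤ dist u v) :
    ‖(‖v - u‖⁻¹ • (v - u) : EuclideanSpace ℝ (Fin 3))‖ = 1 := by
  have h : v - u ≠ 0 := by
    intro h
    rw [dist_comm, dist_eq_norm, h, norm_zero] at hv
    norm_num at hv
  exact norm_smul_inv_norm h

/-- **Clause 3 pointwise.** Two shell points `≥ 7/5` apart have disjoint cap cones of parameter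
`893/1250` about their directions. [folklore] -/
theorem cf_far_capCone {u v w : EuclideanSpace ℝ (Fin 3)}
    (hv : 1 - 1 / 4000 ≤ dist u v ∧ dist u v ≤ 1 + 1 / 4000)
    (hw : 1 - 1 / 4000 ≤ dist u w ∧ dist u w ≤ 1 + 1 / 4000) (hvw : 7 / 5 ≤ dist v w) :
    capCone (‖v - u‖⁻¹ • (v - u)) (893 / 1250) ∩
      capCone (‖w - u‖⁻¹ • (w - u)) (893 / 1250) = ∅ :=
  cf_capCone_inter_eq_empty (cf_norm_dir hv.1) (cf_norm_dir hw.1) (by norm_num)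
    (cf_far_inner hv hw hvw)

/-- **Clause 2 pointwise.** If two shell points `v, w` are `≥ 7/5` apart then, inside the cap
cone of any direction `a`, the regions beyond the bisectors towards `v` and towards `w` are
disjoint (a point of the cap of `a` beyond the bisector towards `v` lies in the cap cone of `v`).
[folklore] -/
theorem cf_far_beyond {u v w : EuclideanSpace ℝ (Fin 3)} (a : EuclideanSpace ℝ (Fin 3))
    (hv : 1 - 1 / 4000 ≤ dist u v ∧ dist u v ≤ 1 + 1 / 4000)
    (hw : 1 - 1 / 4000 ≤ dist u w ∧ dist u w ≤ 1 + 1 / 4000) (hvw : 7 / 5 ≤ dist v w) :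
    capCone a (893 / 1250) ∩
      {x : EuclideanSpace ℝ (Fin 3) | inner ℝ a x < inner ℝ (‖v - u‖⁻¹ • (v - u)) x} ∩
      {x : EuclideanSpace ℝ (Fin 3) | inner ℝ a x < inner ℝ (‖w - u‖⁻¹ • (w - u)) x} = ∅ := by
  have h := cf_far_capCone hv hw hvw
  rw [Set.eq_empty_iff_forall_notMem] at h ⊢
  rintro x ⟨⟨⟨hxa, hball⟩, hxv⟩, hxw⟩
  simp only [Set.mem_setOf_eq] at hxa hxv hxw
  exact h x ⟨⟨lt_trans hxa hxv, hball⟩, ⟨lt_trans hxa hxw, hball⟩⟩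

/-! ## Part E. Two pairs give `ncard ≥ 2` -/

/-- Two distinct unordered pairs satisfying a symmetric relation `S` give two elements of the set
of increasing `S`-pairs. [folklore] -/
theorem cf_two_le_ncard_pairs (T : Set (Fin 12 × Fin 12)) (S : Fin 12 → Fin 12 → Prop)
    (hS : ∀ a b, S a b → S b a) (hT : ∀ a b, S a b → a < b → (a, b) ∈ T) {a b a' b' : Fin 12}
    (hab : a ≠ b) (hab' : a' ≠ b') (h1 : ¬(a = a' ∧ b = b')) (h2 : ¬(a = b' ∧ b = a'))
    (sab : S a b) (sab' : S a' b') : 2 ≤ T.ncard := by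
  have key : ∀ c d c' d' : Fin 12, (c, d) ≠ (c', d') → (c, d) ∈ T → (c', d') ∈ T →
      2 ≤ T.ncard := by
    intro c d c' d' hne hm hm'
    calc 2 = ({(c, d), (c', d')} : Set (Fin 12 × Fin 12)).ncard := (Set.ncard_pair hne).symm
      _ ≤ T.ncard := by
        refine Set.ncard_le_ncard ?_ (Set.toFinite T)
        intro q hq
        simp only [Set.mem_insert_iff, Set.mem_singleton_iff] at hq
        rcases hq with rfl | rfl
        · exact hm
        · exact hm'
  rcases lt_or_gt_of_ne hab with h | h <;> rcases lt_or_gt_of_ne hab' with h' | h'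
  · exact key a b a' b' (fun heq => h1 (Prod.mk.injEq _ _ _ _ ▸ heq)) (hT _ _ sab h)
      (hT _ _ sab' h')
  · exact key a b b' a' (fun heq => h2 (Prod.mk.injEq _ _ _ _ ▸ heq)) (hT _ _ sab h)
      (hT _ _ (hS _ _ sab') h')
  · exact key b a a' b' (fun heq => h2 (And.symm (Prod.mk.injEq _ _ _ _ ▸ heq)))
      (hT _ _ (hS _ _ sab) h) (hT _ _ sab' h')
  · exact key b a b' a' (fun heq => h1 (And.symm (Prod.mk.injEq _ _ _ _ ▸ heq)))
      (hT _ _ (hS _ _ sab) h) (hT _ _ (hS _ _ sab') h')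

/-! ## Part F. The registered auxiliary stub -/

/-- **Registered auxiliary stub `stub_censusFrameAux`** (part 1/2 of `stub_censusFrame`, signature
verbatim): two shell points `1 ± 1/4000` from the centre `u` and `≥ 7/5` apart have disjoint cap
cones of parameter `893/1250` about their directions (`cf_far_capCone`). [folklore] -/
theorem stub_censusFrameAux : ∀ (u v w : EuclideanSpace ℝ (Fin 3)), 1 - 1 / 4000 ≤ dist u v ∧ dist u v ≤ 1 + 1 / 4000 → 1 - 1 / 4000 ≤ dist u w ∧ dist u w ≤ 1 + 1 / 4000 → 7 / 5 ≤ dist v w → Literature.Geometry.DiscreteGeometry.capCone (‖v - u‖⁻¹ • (v - u)) (893 / 1250) ∩ Literature.Geometry.DiscreteGeometry.capCone (‖w - u‖⁻¹ • (w - u)) (893 / 1250) = ∅ :=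
  fun _ _ _ hv hw hvw => cf_far_capCone hv hw hvw

end Summit.AtomisticToContinuum.Crystallization.Theorems.ZeroDefectDensityBirth
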